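import Summits.CriticalPhenomena.PercolationContinuityZ3.Theorems.PercNearOneGluingNoHeavyPcintDefectDiagrams
import Summits.CriticalPhenomena.PercolationContinuityZ3.Theorems.PercNearOneGluingNoHeavyPcintClosingWordDiagram
import HarnessLib

/-!
# CriticalPhenomena/PercolationContinuityZ3 — Theorems/PercNearOneGluingNoHeavyPcintDefectWordDiagram.lean: a one-defect return word is SELF-AVOIDING iff BOTH switched diagrams are IRREDUCIBLE (combinatorial core of STRUCTURE law C5-L4, part 2)

Lane prim-pcint, STRUCTURE rule «numerics ⇒ structure ⇒ conjecture» (prim-pcint-2 GEN 21); sequel of …PcintDefectDiagrams, the one-defect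
analogue of …PcintClosingWordDiagram.  A word `w` of length `K` extended by a virtual closing letter `v` at the top point (`ext w v`) is FULLY
COMPATIBLE (`FCompat π a b`) with a one-defect structure `(π, a, b)` when: off the 4-block `Q` partners carry reversed letters; on `Q` the marked
chords `{a, π a}`, `{b, π b}` carry equal letters, the two chords mutually reversed ones (one axis used four times, twice in each direction); and
equal axes occur only at partners or inside `Q`.  Then for EVERY set `J` of points
  **`Σ_{x ∈ J} stepVec (W x) = 0 ↔ Closed (switchP π a b) J ∨ Closed (switchX π a b) J`** (`sum_stepVec_eq_zero_iff_switch`):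
the off-`Q` letters cancel exactly on `π`-closed sets and the `Q`-letters cancel exactly on balanced sets (…PcintDefectDiagrams
`closed_switch_or_iff`).  Consequently **`isSAW_iff_isGood_switch`: a compatible word is self-avoiding iff both switched diagrams are
irreducible**, and it ends next to the origin (`l1_wordPos_length_of_fcompat`).  The sequels …PcintDefectWordStructure/Count show that every
closing word of length `2m − 1` spanning `m − 1` axes is compatible with exactly one structure and count the fibres.

HONEST FRAMING: elementary finite combinatorics written for the mechanism theorem of law C5-L4 (all `m`).  No `sorry`; standard axioms.
Written by prim-pcint-2 gen 21 (prover-prim-pcint-2-g21-0), 2026-08-27.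
-/

noncomputable section

namespace Summit.CriticalPhenomena.PercolationContinuityZ3.Theorems.Pcint.ChordDiag

open Literature.Probability.LatticeModels Literature.Probability.Percolation
open Summit.CriticalPhenomena.PercolationContinuityZ3.Theorems.Pcint
open Summit.CriticalPhenomena.PercolationContinuityZ3.Theorems.Pcint.MemoryTail

variable {K j : ℕ}

/-! ### Extended words and full compatibility -/

/-- The word extended by a virtual closing letter `v` at the top point `K`. [folklore] -/
def ext (w : Fin K → Fin j × Bool) (v : Fin j × Bool) : Fin (K + 1) → Fin j × Bool := fun x => Fin.lastCases v w x

/-- The extension at a real letter. [folklore] -/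
@[simp] theorem ext_castSucc (w : Fin K → Fin j × Bool) (v : Fin j × Bool) (s : Fin K) : ext w v (Fin.castSucc s) = w s := by
  simp [ext]

/-- The extension at the top. [folklore] -/
@[simp] theorem ext_last (w : Fin K → Fin j × Bool) (v : Fin j × Bool) : ext w v (Fin.last K) = v := by
  simp [ext]

/-- **Full compatibility** of an extended word `W` with the one-defect structure `(π, a, b)`: off `Q` partners carry reversed letters; the
marked chords carry equal letters and are mutually reversed; equal axes occur only at partners or inside `Q`. [folklore] -/
def FCompat (π : Fin (K + 1) → Fin (K + 1)) (a b : Fin (K + 1)) (W : Fin (K + 1) → Fin j × Bool) : Prop :=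
  (∀ x, x ∉ quad π a b → W (π x) = srev (W x)) ∧
    (W (π a) = W a ∧ W (π b) = W b ∧ W b = srev (W a)) ∧
      ∀ x y, x ≠ y → (W x).1 = (W y).1 → π x = y ∨ (x ∈ quad π a b ∧ y ∈ quad π a b)

/-- **Compatibility** of a word with `(π, a, b)`: some virtual closing letter makes its extension fully compatible. [folklore] -/
def DCompat (π : Fin (K + 1) → Fin (K + 1)) (a b : Fin (K + 1)) (w : Fin K → Fin j × Bool) : Prop := ∃ v, FCompat π a b (ext w v)

section Eval

variable {π : Fin (K + 1) → Fin (K + 1)} {a b : Fin (K + 1)} {W : Fin (K + 1) → Fin j × Bool}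

/-- The sign value `±1` of a letter. [folklore] -/
def sgnVal (u : Fin j × Bool) : ℤ := if u.2 then 1 else -1

/-- The sign value is never zero. [folklore] -/
theorem sgnVal_ne_zero (u : Fin j × Bool) : sgnVal u ≠ 0 := by
  unfold sgnVal; split_ifs <;> decide

/-- A step on its own axis is its sign value. [folklore] -/
theorem stepVec_apply_self (u : Fin j × Bool) : stepVec u u.1 = sgnVal u := by
  rw [stepVec_apply_fst]; rfl

/-- All four `Q`-letters lie on the axis of `a`. [folklore] -/
theorem fst_eq_of_mem_quad (hW : FCompat π a b W) {y : Fin (K + 1)} (hy : y ∈ quad π a b) : (W y).1 = (W a).1 := by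
  obtain ⟨-, ⟨h1, h2, h3⟩, -⟩ := hW
  rcases mem_quad.1 hy with rfl | rfl | rfl | rfl
  · rfl
  · rw [h1]
  · rw [h3]; rfl
  · rw [h2, h3]; rfl

/-- A letter with the axis of `a` lies in `Q`. [folklore] -/
theorem mem_quad_of_fst_eq (hW : FCompat π a b W) {y : Fin (K + 1)} (hy : (W y).1 = (W a).1) : y ∈ quad π a b := by
  by_cases hya : y = a
  · rw [hya, mem_quad]; exact Or.inl rfl
  · rcases hW.2.2 a y (Ne.symm hya) hy.symm with h | h
    · rw [← h, mem_quad]; exact Or.inr (Or.inl rfl)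
    · exact h.2

/-- A sum over `J` as a sum of an indicator over everything. [folklore] -/
theorem sum_eq_sum_univ_ite (J : Finset (Fin (K + 1))) (f : Fin (K + 1) → ℤ) :
    ∑ y ∈ J, f y = ∑ y, if y ∈ J then f y else 0 := by
  rw [← Finset.sum_filter, Finset.filter_mem_eq_inter, Finset.univ_inter]

/-- **Coordinate of a block sum on an off-`Q` axis**: only the letter and its partner contribute, with opposite signs. [folklore] -/
theorem sum_apply_offQ (hd : IsDiag π) (hW : FCompat π a b W) {x : Fin (K + 1)} (hx : x ∉ quad π a b) (J : Finset (Fin (K + 1))) :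
    (∑ y ∈ J, stepVec (W y)) (W x).1 = (if x ∈ J then sgnVal (W x) else 0) - (if π x ∈ J then sgnVal (W x) else 0) := by
  classical
  rw [Finset.sum_apply, sum_eq_sum_univ_ite]
  have hxp : x ≠ π x := fun h => (hd x).2 h.symm
  rw [← Finset.sum_subset (Finset.subset_univ ({x, π x} : Finset (Fin (K + 1)))), Finset.sum_pair hxp]
  · congr 1
    · split_ifs
      · exact stepVec_apply_self _
      · rfl
    · rw [hW.1 x hx, stepVec_srev, Pi.neg_apply, stepVec_apply_self]
      split_ifs <;> simp
  · intro y _ hy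
    rw [Finset.mem_insert, Finset.mem_singleton, not_or] at hy
    split_ifs with hyJ
    · rw [stepVec_apply, if_neg]
      intro hc
      rcases hW.2.2 x y (Ne.symm hy.1) hc with h | h
      · exact hy.2 h.symm
      · exact hx h.1
    · rfl

/-- The 4-block as an iterated insertion of distinct points. [folklore] -/
theorem sum_quad (hd : IsDiag π) (h : IsPair π a b) (g : Fin (K + 1) → ℤ) :
    ∑ y ∈ quad π a b, g y = g a + g (π a) + g b + g (π b) := by
  obtain ⟨d1, d2, d3, d4, d5, d6⟩ := h.distinct hd
  unfold quad
  rw [Finset.sum_insert, Finset.sum_insert, Finset.sum_pair d2]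
  · ring
  · simp [Ne.symm d4, d6]
  · simp [d1, d3, d5]

/-- **Coordinate of a block sum on the `Q`-axis**: `sgn(a)·(#(J ∩ {a, π a}) − #(J ∩ {b, π b}))`. [folklore] -/
theorem sum_apply_Q (hd : IsDiag π) (h : IsPair π a b) (hW : FCompat π a b W) (J : Finset (Fin (K + 1))) :
    (∑ y ∈ J, stepVec (W y)) (W a).1 = sgnVal (W a) * ((qcount a (π a) J : ℤ) - (qcount b (π b) J : ℤ)) := by
  classical
  obtain ⟨h1, h2, h3⟩ := hW.2.1
  rw [Finset.sum_apply, sum_eq_sum_univ_ite,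
    ← Finset.sum_subset (Finset.subset_univ (quad π a b)), sum_quad hd h]
  · have ea : stepVec (W a) (W a).1 = sgnVal (W a) := stepVec_apply_self _
    have epa : stepVec (W (π a)) (W a).1 = sgnVal (W a) := by rw [h1, ea]
    have eb : stepVec (W b) (W a).1 = -sgnVal (W a) := by rw [h3, stepVec_srev, Pi.neg_apply, ea]
    have epb : stepVec (W (π b)) (W a).1 = -sgnVal (W a) := by rw [h2, eb]
    rw [ea, epa, eb, epb]
    unfold qcount
    split_ifs <;> push_cast <;> ring
  · intro y _ hy
    split_ifs with hyJ
    · rw [stepVec_apply, if_neg]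
      intro hc
      exact hy (mem_quad_of_fst_eq hW hc.symm)
    · rfl

/-- Coordinates on unused axes vanish. [folklore] -/
theorem sum_apply_unused {c : Fin j} (hc : ∀ y, (W y).1 ≠ c) (J : Finset (Fin (K + 1))) :
    (∑ y ∈ J, stepVec (W y)) c = 0 := by
  rw [Finset.sum_apply]
  refine Finset.sum_eq_zero fun y _ => ?_
  rw [stepVec_apply, if_neg (fun h => hc y h.symm)]

/-- **Block sums vanish exactly on the closed sets of the switched diagrams.** [folklore] -/
theorem sum_stepVec_eq_zero_iff_switch (hd : IsDiag π) (h : IsPair π a b) (hW : FCompat π a b W) (J : Finset (Fin (K + 1))) :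
    ∑ y ∈ J, stepVec (W y) = 0 ↔ Closed (switchP π a b) J ∨ Closed (switchX π a b) J := by
  rw [closed_switch_or_iff hd h]
  constructor
  · intro hs
    refine ⟨fun x hx hxJ => ?_, ?_⟩
    · have h1 := congrFun hs (W x).1
      rw [sum_apply_offQ hd hW hx, Pi.zero_apply, if_pos hxJ] at h1
      by_contra hpx
      rw [if_neg hpx, sub_zero] at h1
      exact sgnVal_ne_zero _ h1
    · have h1 := congrFun hs (W a).1
      rw [sum_apply_Q hd h hW, Pi.zero_apply] at h1
      rcases mul_eq_zero.1 h1 with h2 | h2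
      · exact absurd h2 (sgnVal_ne_zero _)
      · unfold Balanced; exact_mod_cast sub_eq_zero.1 h2
  · rintro ⟨hoff, hbal⟩
    funext c
    rw [Pi.zero_apply]
    by_cases hc : ∃ y, (W y).1 = c
    · obtain ⟨y, rfl⟩ := hc
      by_cases hy : y ∈ quad π a b
      · rw [fst_eq_of_mem_quad hW hy, sum_apply_Q hd h hW]
        unfold Balanced at hbal
        rw [hbal, sub_self, mul_zero]
      · rw [sum_apply_offQ hd hW hy]
        have hy' : π y ∉ quad π a b := fun h' => hy ((mem_quad_apply hd).1 h')
        have key : y ∈ J ↔ π y ∈ J := ⟨hoff y hy, fun hp => by have := hoff (π y) hy' hp; rwa [(hd y).1] at this⟩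
        by_cases hyJ : y ∈ J
        · rw [if_pos hyJ, if_pos (key.1 hyJ), sub_self]
        · rw [if_neg hyJ, if_neg (fun hp => hyJ (key.2 hp)), sub_zero]
    · push Not at hc
      exact sum_apply_unused hc J

end Eval

/-! ### Consequences for compatible words -/

section Word

variable {π : Fin (K + 1) → Fin (K + 1)} {a b : Fin (K + 1)} {w : Fin K → Fin j × Bool} {v : Fin j × Bool}

/-- Letter sums are point sums of the extension. [folklore] -/
theorem sum_stepVec_ext (w : Fin K → Fin j × Bool) (v : Fin j × Bool) (I : Finset (Fin K)) :
    ∑ t ∈ I, stepVec (w t) = ∑ x ∈ I.map Fin.castSuccEmb, stepVec (ext w v x) := by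
  rw [Finset.sum_map]
  exact Finset.sum_congr rfl fun t _ => by rw [Fin.coe_castSuccEmb, ext_castSucc]

/-- **A compatible word is self-avoiding iff both switched diagrams are irreducible.** [folklore] -/
theorem isSAW_iff_isGood_switch (hd : IsDiag π) (h : IsPair π a b) (hW : FCompat π a b (ext w v)) :
    IsSAW w ↔ IsGood (switchP π a b) ∧ IsGood (switchX π a b) := by
  rw [isSAW_iff_blocks, isGood_iff_blocks (isDiag_switchP hd h), isGood_iff_blocks (isDiag_switchX hd h)]
  have key : ∀ a' r, 1 ≤ r → a' + r ≤ K →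
      (∑ t ∈ blockOf K a' r, stepVec (w t) ≠ 0 ↔
        ¬ Closed (switchP π a b) (blockOf (K + 1) a' r) ∧ ¬ Closed (switchX π a b) (blockOf (K + 1) a' r)) := by
    intro a' r _ hK
    rw [Ne, sum_stepVec_ext w v, sum_stepVec_eq_zero_iff_switch hd h hW, map_castSucc_blockOf hK, not_or]
  constructor
  · intro H
    exact ⟨fun a' r hr hK => ((key a' r hr hK).1 (H a' r hr hK)).1, fun a' r hr hK => ((key a' r hr hK).1 (H a' r hr hK)).2⟩
  · rintro ⟨H1, H2⟩ a' r hr hK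
    exact (key a' r hr hK).2 ⟨H1 a' r hr hK, H2 a' r hr hK⟩

/-- The steps of a fully compatible extended word sum to zero. [folklore] -/
theorem sum_univ_stepVec_ext (hd : IsDiag π) (h : IsPair π a b) (hW : FCompat π a b (ext w v)) :
    ∑ x, stepVec (ext w v x) = 0 :=
  (sum_stepVec_eq_zero_iff_switch hd h hW Finset.univ).2 (Or.inl fun _ _ => Finset.mem_univ _)

/-- **The endpoint of a compatible word is the reversed virtual letter.** [folklore] -/
theorem wordPos_length_eq_of_fcompat (hd : IsDiag π) (h : IsPair π a b) (hW : FCompat π a b (ext w v)) :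
    wordPos w K = stepVec (srev v) := by
  have h1 := sum_univ_stepVec_ext hd h hW
  rw [Fin.sum_univ_castSucc, ext_last] at h1
  simp only [ext_castSucc] at h1
  rw [wordPos_length_eq_sum, stepVec_srev]
  exact eq_neg_of_add_eq_zero_left h1

/-- **A compatible word ends next to the origin.** [folklore] -/
theorem l1_wordPos_length_of_fcompat (hd : IsDiag π) (h : IsPair π a b) (hW : FCompat π a b (ext w v)) :
    l1 (wordPos w K) = 1 := by
  rw [wordPos_length_eq_of_fcompat hd h hW, l1_stepVec]

end Word

end Summit.CriticalPhenomena.PercolationContinuityZ3.Theorems.Pcint.ChordDiag
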